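import Summits.QuantumFields.BalabanUV.Beta.GAN24.FlatResolventStep
import Summits.QuantumFields.BalabanUV.Beta.GAN24.ScalarFlatDictionary

/-!
# G-an2-4 ∕ (CONV-C), the SCALAR second-order sup letters — part 3, THE END OF THE LINE: first- and second-order block rows of
# the scalar averaged propagator `𝒢′ = (Δ + a′Π′)⁻¹` — `Σ_{x′∈B(y′)} ‖(𝒢′∂_νᴴ)(x,x′)‖, Σ ‖(∂_ν𝒢′)(x,x′)‖ ≤ B·e^{−δ·dist}` and
# `Σ_{x′∈B(y′)} ‖(𝒢′∂_μᴴ∂_νᴴ)(x,x′)‖, Σ ‖(∂_μᴴ∂_ν𝒢′)(x,x′)‖ ≤ B·(1 + log n)·e^{−δ·dist}`, n-UNIFORM — FROM its zeroth-order block rows ((s0))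

G-an2-4 formalisation swarm `b2b-balaban-gan24-formalise-*`, leaf prover 06 (gen 35), crux team (2) under the coordinator ruling
«YM REDIRECT» (e34b3e0c).  The road-P2 crux prover's consumer (`GAN24/StaircaseLaplacianDefect` p253982 → `SoftMinimiserOneStepSup`)
costs the sup→sup norms `‖𝒢′∂′ᴴ∂′ᴴ‖_{∞→∞}`, `‖𝒢′∂′ᴴ‖_{∞→∞}` of NE2's SCALAR `𝒢′ = ScalarAveragedPropagator.Gps n M a′`, for which the
tree holds only `ℓ²`∕Combes–Thomas bounds.  THIS FILE composes the line: part 1 `GAN24/FlatResolventStep.resolventStep_bounds` (the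
abstract flat resolvent step around the free massive resolvent of the NE3 lineage, with the located logarithm of the free second
difference), part 2 `GAN24/ScalarFlatLift` (`𝒢′ ⊗ 1` on the NE3 carrier inverts `stencilE + (a′/n²)·(Π′ ⊗ 1)`, block-diagonal mass rows
`a′/n²`) and part 2b `GAN24/ScalarFlatDictionary` (block rows of `𝒢′` IN, column differences OUT):
 * §1 **`scalar_resolventStep`** — for `a′ > 0` and constants `(C, δ₀)`, there are `B, δ > 0` (functions of `d, a′, C, δ₀`) such that at
   every level `(k, N, L, j ≤ k)` at which the ZEROTH-order block rows of `𝒢′` on the fine torus (`n = L^j` sites per block side,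
   `N·L^{k−j}` blocks per direction) obey `Σ_{r′} ‖𝒢′(n·x̄ + r, n·x̄′ + r′)‖ ≤ C·e^{−δ₀|x − x′|_{T₁,∞}}` (HYPOTHESIS — the ROW shape of the
   (s0)∕(K₀ˢ) END `gps_block_row_sum_le` announced by leaf-01 gen 55; NOT in the tree at the time of writing), the four cube-row
   bounds of part 1 hold for `Gs = n²·RI j (Re 𝒢′ ⊗ 1)`: `∇_νGs ≤ B·L^j`, `∇_μ∇_νGs ≤ B·(1 + log L^j)`, `Gs·colDiff ν ≤ B·L^j`,
   `Gs·colDiff μ·colDiff ν ≤ B·(1 + log L^j)`, each `× e^{−δ·nbd}`; **`scalar_resolventStep_of_uniform`** — the same from the n- and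
   volume-UNIFORM hypothesis (leaf-01's END shape verbatim after `∃`-elimination);
 * §2 **`scalar_block_rows`** — the same data give, on Bałaban's fine torus itself and in pv15's block currency (the `hK`∕`h` shape of
   leaf-04's staged `GAN24/ScalarSupReductions`), for all directions `μ, ν`, every row `x` and block `y′` (`dist = |blk(x) − y′|_{T₁,∞}`,
   `∂_ν = sdiff (fine n M) n ν`, `η`-normalised; ONE pair of n-UNIFORM constants):
   `Σ_{x′ ∈ B(y′)} ‖(𝒢′·∂_νᴴ)(x,x′)‖ ≤ B·e^{−δ·dist}` (the per-block form of letter (L1) `G′∇*`),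
   `Σ_{x′ ∈ B(y′)} ‖(𝒢′·∂_μᴴ·∂_νᴴ)(x,x′)‖ ≤ B·(1 + log n)·e^{−δ·dist}` ((L3) `G′∇*∇*`),
   `Σ_{x′ ∈ B(y′)} ‖(∂_ν·𝒢′)(x,x′)‖ ≤ B·e^{−δ·dist}` ((L2) `∇G′`),
   `Σ_{x′ ∈ B(y′)} ‖(∂_μᴴ·∂_ν·𝒢′)(x,x′)‖ ≤ B·(1 + log n)·e^{−δ·dist}` ((L4) `∇*∇G′`; the backward shift of the row costs `e^{δ(d+1)}`,
   absorbed in `B`: `nbd_cube_shift_le`, `nbd_triangle`, `exp_nbd_shift_le`); `1 + log n` is the located Calderón–Zygmund endpoint.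
Every `n ≥ 1` and every CUBIC unit torus `N₀` is the instance `(k, N, L, j) = (1, N₀, n, 1)`; the `∃ C`-packaged sup letters
(L1)–(L4) of INTERFACE REQUEST G-an2-4 (SCALAR-LETTERS) follow by pv15's resummation (`latticeConst`; leaf-04's
`ScalarSupReductions.norm_mulVec_le_of_block_row_sum_scalar`) — that junction module is not part of this file.

HONEST SCOPE.  A REDUCTION: «scalar first∕second-order block rows ⇐ scalar zeroth-order block rows»; the zeroth-order input is a
HYPOTHESIS (item (s0), leaf-01 gen 55's line; located text: [B9] Thm 3.1 (3.42) `m = 0` p. 397 at `U = 1` — a TEXT LOCATION, nothing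
printed is used).  [folklore] lattice analysis of the cell's typed `U = 1` objects; constants existential, functions of `(d, a′, C, δ₀)`;
no `def`, no `def … : Prop`, no `sorry`.  Bałaban prints (1.110)∕(1.112) for the VECTOR `G` ([B5] pp. 35–36, Hölder-source form) — the
scalar `(1 + log n)` block-row letters are OURS, not a quotation.  NOT (CONV-C), NEVER «G-an2-4 closed», NOT NE2 ∕ NE3, NOT D1, NOT
BetaPertH, NOT continuum, NOT Clay; not in print — our bookkeeping.  ABSOLUTE RULE of the cell kept.  HONEST DEPENDENCY: continuum YM on
T⁴ ⇐ BetaPertH ∧ nine spine estimates (0/9 proved); BetaPertH ⇐ (D1) ∧ (D4) ∧ CAP+tail; G-an2-4 gates asym, D1 and NE2/3/4.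
-/

noncomputable section

open scoped BigOperators ComplexConjugate Matrix Kronecker
open Finset

namespace Summit.QuantumFields.BalabanUV.Beta.GAN24.ScalarFlatResolvent

open Literature.MathematicalPhysics.QuantumFieldTheory.Balaban1983to89
open Literature.MathematicalPhysics.QuantumFieldTheory.Balaban1983to89.TreeLengthTorus (TPt)
open Literature.MathematicalPhysics.QuantumFieldTheory.Balaban1983to89.B5Prop11Plancherel (Tor fine unitVec)
open Literature.MathematicalPhysics.QuantumFieldTheory.Balaban1983to89.B5Action121 (sdiff)
open Literature.MathematicalPhysics.QuantumFieldTheory.Balaban1983to89.B5Block118 (bpt)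
open Literature.MathematicalPhysics.QuantumFieldTheory.Balaban1983to89.B6LowerBound2153Torus (toT rep)
open Literature.MathematicalPhysics.QuantumFieldTheory.Balaban1983to89.B4TorusKernel.MultiPeriod (torusSupNorm)
open Literature.MathematicalPhysics.QuantumFieldTheory.Balaban1983to89.B5RealFields (reM)
open Summit.QuantumFields.BalabanUV.T4Continuum
open SliceTorusTower SliceCovariantTower SliceFlatPropagator SliceFlatOperators SliceFlatStencil
open Summit.QuantumFields.BalabanUV.T4Continuum.SliceFlatFreeResolvent (rowDiff)
open Summit.QuantumFields.BalabanUV.T4Continuum.SliceFlatGradientPrep (colDiff)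
open Summit.QuantumFields.BalabanUV.T4Continuum.GradientRowSumTransport (blockOf_eF torusSupNorm_rep_sub_rep_le_nbd)
open Summit.QuantumFields.BalabanUV.T4Continuum.ScalarBlockPoincare (PiS)
open Summit.QuantumFields.BalabanUV.T4Continuum.ScalarAveragedPropagator (Gps)
open Summit.QuantumFields.BalabanUV.T4Continuum.SliceTorusBlocks (npl1)
open Summit.QuantumFields.BalabanUV.Beta.GAN24.FlatResolventStep (resolventStep_bounds)
open Summit.QuantumFields.BalabanUV.Beta.GAN24.ScalarFlatLift
open Summit.QuantumFields.BalabanUV.Beta.GAN24.ScalarFlatDictionary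

variable (d : ℕ)

/-! ## §1  The four cube-row bounds for `Gs = n²·RI j (Re 𝒢′ ⊗ 1)` from the zeroth-order block rows of `𝒢′` -/

/-- **THE SCALAR FLAT RESOLVENT STEP (per level).**  For `a′ > 0` and constants `C ≥ 0`, `δ₀ > 0` there are `B, δ > 0` such that at
every level `(k, N, L, j ≤ k)` where the zeroth-order block rows of `𝒢′ = Gps (L^j) (N·L^{k−j}) a′` obey
`Σ_{r′} ‖𝒢′(n·x̄ + r, n·x̄′ + r′)‖ ≤ C·e^{−δ₀|x − x′|_{T₁,∞}}` (HYPOTHESIS, item (s0)), the lifted `Gs = n²·RI j (Re 𝒢′ ⊗ 1)` has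
cube rows `Σ_{q∈Δ_j(y₁)} |rowDiff ν Gs p q| ≤ B·L^j·e^{−δ·nbd}`, `Σ |rowDiff μ (rowDiff ν Gs) p q| ≤ B·(1 + log L^j)·e^{−δ·nbd}`,
`Σ |(Gs·colDiff ν) p q| ≤ B·L^j·e^{−δ·nbd}`, `Σ |(Gs·colDiff μ·colDiff ν) p q| ≤ B·(1 + log L^j)·e^{−δ·nbd}`. [folklore] -/
theorem scalar_resolventStep {a' C δ₀ : ℝ} (ha' : 0 < a') (hC : 0 ≤ C) (hδ₀ : 0 < δ₀) :
    ∃ B δ : ℝ, 0 < B ∧ 0 < δ ∧ ∀ (k N L : ℕ) [NeZero N] [NeZero L] (j : ℕ), j ≤ k →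
      (∀ (x x' : Fin (d + 1) → ℤ) (r : Fin (d + 1) → Fin (side k L j)),
        ∑ r' : Fin (d + 1) → Fin (side k L j),
            ‖Gps (side k L j) (Mlev d k N L j) a' (bpt (side k L j) (Mlev d k N L j) (toT (Mlev d k N L j) x) r)
                (bpt (side k L j) (Mlev d k N L j) (toT (Mlev d k N L j) x') r')‖
          ≤ C * Real.exp (-(δ₀ * torusSupNorm (Mlev d k N L j) (x - x')))) →
      ∀ (μ ν : Fin (d + 1)) (p : TPt (d + 1) (N * L ^ k) × Fin (d + 1)) (y₁ : TPt (d + 1) (levM k N L j)),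
        (∑ q ∈ Finset.univ.filter (fun q => cubeI (d + 1) k N L (Fin (d + 1)) j q = y₁),
            |rowDiff d k N L ν (((side k L j : ℝ) ^ 2) • RI d k N L j
              (reM (Gps (side k L j) (Mlev d k N L j) a') ⊗ₖ (1 : Matrix (Fin (d + 1)) (Fin (d + 1)) ℝ))) p q|
          ≤ B * (L : ℝ) ^ j * Real.exp (-(δ * nbd (d + 1) k N L j (cubeI (d + 1) k N L (Fin (d + 1)) j p) y₁))) ∧
        (∑ q ∈ Finset.univ.filter (fun q => cubeI (d + 1) k N L (Fin (d + 1)) j q = y₁),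
            |rowDiff d k N L μ (rowDiff d k N L ν (((side k L j : ℝ) ^ 2) • RI d k N L j
              (reM (Gps (side k L j) (Mlev d k N L j) a') ⊗ₖ (1 : Matrix (Fin (d + 1)) (Fin (d + 1)) ℝ)))) p q|
          ≤ B * (1 + Real.log ((L : ℝ) ^ j))
            * Real.exp (-(δ * nbd (d + 1) k N L j (cubeI (d + 1) k N L (Fin (d + 1)) j p) y₁))) ∧
        (∑ q ∈ Finset.univ.filter (fun q => cubeI (d + 1) k N L (Fin (d + 1)) j q = y₁),
            |((((side k L j : ℝ) ^ 2) • RI d k N L j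
              (reM (Gps (side k L j) (Mlev d k N L j) a') ⊗ₖ (1 : Matrix (Fin (d + 1)) (Fin (d + 1)) ℝ))) * colDiff d k N L ν) p q|
          ≤ B * (L : ℝ) ^ j * Real.exp (-(δ * nbd (d + 1) k N L j (cubeI (d + 1) k N L (Fin (d + 1)) j p) y₁))) ∧
        (∑ q ∈ Finset.univ.filter (fun q => cubeI (d + 1) k N L (Fin (d + 1)) j q = y₁),
            |((((side k L j : ℝ) ^ 2) • RI d k N L j
              (reM (Gps (side k L j) (Mlev d k N L j) a') ⊗ₖ (1 : Matrix (Fin (d + 1)) (Fin (d + 1)) ℝ)))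
                * colDiff d k N L μ * colDiff d k N L ν) p q|
          ≤ B * (1 + Real.log ((L : ℝ) ^ j))
            * Real.exp (-(δ * nbd (d + 1) k N L j (cubeI (d + 1) k N L (Fin (d + 1)) j p) y₁))) := by
  have hd1 : (0 : ℝ) < d + 1 := by positivity
  obtain ⟨B, δ, hB, hδ, h⟩ := resolventStep_bounds d (CM := a') (δM := 1) (CG := C) (δG := δ₀ / (d + 1))
    ha'.le one_pos hC (div_pos hδ₀ hd1)
  refine ⟨B, δ, hB, hδ, fun k N L _ _ j hj hrow μ ν p y₁ => ?_⟩
  obtain ⟨hKG, hGK⟩ := stencil_add_mass_mul_Gs d k N L j ha'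
  exact h k N L j hj _ _ hKG hGK (fun x b => cubeSum_mass_le d k N L ha'.le hj 1 x b)
    (fun x b => cubeSum_Gs_le_of_block_rows hδ₀.le hj hrow x b) μ ν p y₁

/-- **THE SCALAR FLAT RESOLVENT STEP from the UNIFORM zeroth-order block rows** (the (s0)∕(K₀ˢ) END shape of leaf-01 gen 55 after
`∃`-elimination: every `n ≥ 1`, every torus `M`). [folklore] -/
theorem scalar_resolventStep_of_uniform {a' C δ₀ : ℝ} (ha' : 0 < a') (hC : 0 ≤ C) (hδ₀ : 0 < δ₀)
    (hrow : ∀ (n : ℕ) [NeZero n] (M : Fin (d + 1) → ℕ) [∀ μ, NeZero (M μ)] (x x' : Fin (d + 1) → ℤ) (r : Fin (d + 1) → Fin n),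
      ∑ r' : Fin (d + 1) → Fin n, ‖Gps n M a' (bpt n M (toT M x) r) (bpt n M (toT M x') r')‖
        ≤ C * Real.exp (-(δ₀ * torusSupNorm M (x - x')))) :
    ∃ B δ : ℝ, 0 < B ∧ 0 < δ ∧ ∀ (k N L : ℕ) [NeZero N] [NeZero L] (j : ℕ), j ≤ k →
      ∀ (μ ν : Fin (d + 1)) (p : TPt (d + 1) (N * L ^ k) × Fin (d + 1)) (y₁ : TPt (d + 1) (levM k N L j)),
        (∑ q ∈ Finset.univ.filter (fun q => cubeI (d + 1) k N L (Fin (d + 1)) j q = y₁),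
            |rowDiff d k N L ν (((side k L j : ℝ) ^ 2) • RI d k N L j
              (reM (Gps (side k L j) (Mlev d k N L j) a') ⊗ₖ (1 : Matrix (Fin (d + 1)) (Fin (d + 1)) ℝ))) p q|
          ≤ B * (L : ℝ) ^ j * Real.exp (-(δ * nbd (d + 1) k N L j (cubeI (d + 1) k N L (Fin (d + 1)) j p) y₁))) ∧
        (∑ q ∈ Finset.univ.filter (fun q => cubeI (d + 1) k N L (Fin (d + 1)) j q = y₁),
            |rowDiff d k N L μ (rowDiff d k N L ν (((side k L j : ℝ) ^ 2) • RI d k N L j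
              (reM (Gps (side k L j) (Mlev d k N L j) a') ⊗ₖ (1 : Matrix (Fin (d + 1)) (Fin (d + 1)) ℝ)))) p q|
          ≤ B * (1 + Real.log ((L : ℝ) ^ j))
            * Real.exp (-(δ * nbd (d + 1) k N L j (cubeI (d + 1) k N L (Fin (d + 1)) j p) y₁))) ∧
        (∑ q ∈ Finset.univ.filter (fun q => cubeI (d + 1) k N L (Fin (d + 1)) j q = y₁),
            |((((side k L j : ℝ) ^ 2) • RI d k N L j
              (reM (Gps (side k L j) (Mlev d k N L j) a') ⊗ₖ (1 : Matrix (Fin (d + 1)) (Fin (d + 1)) ℝ))) * colDiff d k N L ν) p q|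
          ≤ B * (L : ℝ) ^ j * Real.exp (-(δ * nbd (d + 1) k N L j (cubeI (d + 1) k N L (Fin (d + 1)) j p) y₁))) ∧
        (∑ q ∈ Finset.univ.filter (fun q => cubeI (d + 1) k N L (Fin (d + 1)) j q = y₁),
            |((((side k L j : ℝ) ^ 2) • RI d k N L j
              (reM (Gps (side k L j) (Mlev d k N L j) a') ⊗ₖ (1 : Matrix (Fin (d + 1)) (Fin (d + 1)) ℝ)))
                * colDiff d k N L μ * colDiff d k N L ν) p q|
          ≤ B * (1 + Real.log ((L : ℝ) ^ j))
            * Real.exp (-(δ * nbd (d + 1) k N L j (cubeI (d + 1) k N L (Fin (d + 1)) j p) y₁))) := by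
  obtain ⟨B, δ, hB, hδ, h⟩ := scalar_resolventStep d ha' hC hδ₀
  exact ⟨B, δ, hB, hδ, fun k N L _ _ j hj => h k N L j hj (fun x x' r => hrow (side k L j) (Mlev d k N L j) x x' r)⟩

/-! ## §2  Back on Bałaban's fine torus: block rows of `𝒢′∂_νᴴ`, `𝒢′∂_μᴴ∂_νᴴ`, `∂_ν𝒢′`, `∂_μᴴ∂_ν𝒢′`, n-uniform -/

section Block

variable {d} {k N L : ℕ} [NeZero N] [NeZero L] {j : ℕ}

/-- A Bałaban-block row of a scalar-torus matrix, pulled back along `eF`, is dominated by the cube row of any carrier matrix whose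
entries (at some carrier row `pA`, internal component `0`) dominate it. [folklore] -/
theorem block_row_le_cube_row (K : Matrix (Tor (fine (side k L j) (Mlev d k N L j))) (Tor (fine (side k L j) (Mlev d k N L j))) ℂ)
    (A : Matrix (TPt (d + 1) (N * L ^ k) × Fin (d + 1)) (TPt (d + 1) (N * L ^ k) × Fin (d + 1)) ℝ) {c : ℝ}
    (z : TPt (d + 1) (N * L ^ k)) (pA : TPt (d + 1) (N * L ^ k) × Fin (d + 1))
    (hKA : ∀ x : TPt (d + 1) (N * L ^ k), c * ‖K (eF d k N L j z) (eF d k N L j x)‖ = |A pA (x, 0)|)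
    (y' : TPt (d + 1) (levM k N L j)) :
    c * ∑ x' : Tor (fine (side k L j) (Mlev d k N L j)),
        (if B5Blocks16.blockOf (side k L j) (Mlev d k N L j) x' = y' then ‖K (eF d k N L j z) x'‖ else 0)
      ≤ ∑ q ∈ Finset.univ.filter (fun q => cubeI (d + 1) k N L (Fin (d + 1)) j q = y'), |A pA q| := by
  -- reindex the block along `eF` and trade `K` for `A` on the component `0`
  have h1 : c * ∑ x' : Tor (fine (side k L j) (Mlev d k N L j)),
        (if B5Blocks16.blockOf (side k L j) (Mlev d k N L j) x' = y' then ‖K (eF d k N L j z) x'‖ else 0)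
      = ∑ x : TPt (d + 1) (N * L ^ k), (if cube (d + 1) k N L j x = y' then |A pA (x, 0)| else 0) := by
    rw [← Equiv.sum_comp (eF d k N L j), Finset.mul_sum]
    refine Finset.sum_congr rfl fun x _ => ?_
    rw [blockOf_eF]
    split_ifs
    · exact hKA x
    · rw [mul_zero]
  rw [h1, Finset.sum_filter, Fintype.sum_prod_type]
  refine Finset.sum_le_sum fun x _ => ?_
  simp only [cubeI_apply]
  split_ifs with h
  · exact Finset.single_le_sum (f := fun c' : Fin (d + 1) => |A pA (x, c')|) (fun _ _ => abs_nonneg _) (Finset.mem_univ 0)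
  · simp

/-- **Block distance of a unit shift**: the cubes of `z` and `z − e_μ` are at ℓ¹ block distance `≤ d + 1` (crudely; from NE3's
`mul_nbd_le_rhoI` and part 1 (i)'s `rhoI_shift1_le`). [folklore] -/
theorem nbd_cube_shift_le (μ : Fin (d + 1)) (z : TPt (d + 1) (N * L ^ k)) :
    (nbd (d + 1) k N L j (cube (d + 1) k N L j z) (cube (d + 1) k N L j (z - Pi.single μ 1)) : ℝ) ≤ d + 1 := by
  have hn1 : (1 : ℝ) ≤ (side k L j : ℝ) := by exact_mod_cast one_le_side k L j
  have h := SliceFlatGradientPrep.mul_nbd_le_rhoI d k N L j ((z, (0 : Fin (d + 1))) : TPt (d + 1) (N * L ^ k) × Fin (d + 1))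
    (z - Pi.single μ 1, 0)
  have hs := FlatResolventPieces.rhoI_shift1_le d k N L μ ((z, (0 : Fin (d + 1))) : TPt (d + 1) (N * L ^ k) × Fin (d + 1))
  simp only [cubeI_apply] at h
  have hD : 0 ≤ (nbd (d + 1) k N L j (cube (d + 1) k N L j z) (cube (d + 1) k N L j (z - Pi.single μ 1)) : ℝ) := Nat.cast_nonneg _
  -- `n·D ≤ 1 + (d+1)(n−1) ≤ (d+1)·n`
  nlinarith

/-- The triangle inequality of the ℓ¹ block distance. [folklore] -/
theorem nbd_triangle (a b c : TPt (d + 1) (levM k N L j)) :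
    nbd (d + 1) k N L j a c ≤ nbd (d + 1) k N L j a b + nbd (d + 1) k N L j b c := by
  have h := SliceTorusBlocks.npl1_sub_tri4 a b c c
  simp only [sub_self] at h
  unfold nbd
  have h0 : npl1 (0 : TPt (d + 1) (levM k N L j)) = 0 := by simp [npl1]
  omega

/-- **The decay factor at a shifted row**: `e^{−δ·nbd(Δ(z − e_μ), y′)} ≤ e^{δ(d+1)}·e^{−δ·nbd(Δ(z), y′)}` (`δ ≥ 0`). [folklore] -/
theorem exp_nbd_shift_le {δ : ℝ} (hδ : 0 ≤ δ) (μ : Fin (d + 1)) (z : TPt (d + 1) (N * L ^ k)) (y' : TPt (d + 1) (levM k N L j)) :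
    Real.exp (-(δ * nbd (d + 1) k N L j (cube (d + 1) k N L j (z - Pi.single μ 1)) y'))
      ≤ Real.exp (δ * (d + 1)) * Real.exp (-(δ * nbd (d + 1) k N L j (cube (d + 1) k N L j z) y')) := by
  rw [← Real.exp_add]
  refine Real.exp_le_exp.mpr ?_
  have ht := nbd_triangle (cube (d + 1) k N L j z) (cube (d + 1) k N L j (z - Pi.single μ 1)) y'
  have hs := nbd_cube_shift_le (j := j) μ z
  have ht' : (nbd (d + 1) k N L j (cube (d + 1) k N L j z) y' : ℝ)
      ≤ nbd (d + 1) k N L j (cube (d + 1) k N L j z) (cube (d + 1) k N L j (z - Pi.single μ 1))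
        + nbd (d + 1) k N L j (cube (d + 1) k N L j (z - Pi.single μ 1)) y' := by exact_mod_cast ht
  nlinarith

variable (d)

/-- **THE SCALAR FIRST- AND SECOND-ORDER BLOCK-ROW LETTERS, n-UNIFORM, FROM THE ZEROTH-ORDER BLOCK ROWS** — operator AND row
forms.  For `a′ > 0`, `C ≥ 0`, `δ₀ > 0` there are `B, δ > 0` (functions of `d, a′, C, δ₀`) such that at every level `(k, N, L, j ≤ k)`
(`n = L^j` sites per block side, `N·L^{k−j}` blocks per direction) at which the zeroth-order block rows of `𝒢′ = Gps n M a′` obey the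
(s0) hypothesis, for every pair of directions `μ, ν`, every row `x` and every block `y′` of Bałaban's fine torus (`∂_ν = sdiff (fine n M) n ν`,
`dist = |blk(x) − y′|_{T₁,∞}`):
`Σ_{x′ ∈ B(y′)} ‖(𝒢′·∂_νᴴ)(x,x′)‖ ≤ B·e^{−δ·dist}`, `Σ_{x′ ∈ B(y′)} ‖(𝒢′·∂_μᴴ·∂_νᴴ)(x,x′)‖ ≤ B·(1 + log n)·e^{−δ·dist}`,
`Σ_{x′ ∈ B(y′)} ‖(∂_ν·𝒢′)(x,x′)‖ ≤ B·e^{−δ·dist}`, `Σ_{x′ ∈ B(y′)} ‖(∂_μᴴ·∂_ν·𝒢′)(x,x′)‖ ≤ B·(1 + log n)·e^{−δ·dist}` — the per-block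
forms of the requester's letters (L1) `G′∇*`, (L3) `G′∇*∇*`, (L2) `∇G′`, (L4) `∇*∇G′` (INTERFACE REQUEST G-an2-4 (SCALAR-LETTERS),
`HOME/INBOX.md` 2026-08-21T08:13Z).  (Location of the analogous printed VECTOR entries: [B5] `Balaban1984PropagatorsI` pp. 35–36,
(1.110)∕(1.112); the scalar block-row inequalities with `1 + log n` are ours, not a quotation.) [folklore] -/
theorem scalar_block_rows {a' C δ₀ : ℝ} (ha' : 0 < a') (hC : 0 ≤ C) (hδ₀ : 0 < δ₀) :
    ∃ B δ : ℝ, 0 < B ∧ 0 < δ ∧ ∀ (k N L : ℕ) [NeZero N] [NeZero L] (j : ℕ), j ≤ k →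
      (∀ (x x' : Fin (d + 1) → ℤ) (r : Fin (d + 1) → Fin (side k L j)),
        ∑ r' : Fin (d + 1) → Fin (side k L j),
            ‖Gps (side k L j) (Mlev d k N L j) a' (bpt (side k L j) (Mlev d k N L j) (toT (Mlev d k N L j) x) r)
                (bpt (side k L j) (Mlev d k N L j) (toT (Mlev d k N L j) x') r')‖
          ≤ C * Real.exp (-(δ₀ * torusSupNorm (Mlev d k N L j) (x - x')))) →
      ∀ (μ ν : Fin (d + 1)) (x : Tor (fine (side k L j) (Mlev d k N L j))) (y' : TPt (d + 1) (levM k N L j)),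
        (∑ x' : Tor (fine (side k L j) (Mlev d k N L j)),
            (if B5Blocks16.blockOf (side k L j) (Mlev d k N L j) x' = y' then
              ‖(Gps (side k L j) (Mlev d k N L j) a' * (sdiff (fine (side k L j) (Mlev d k N L j)) (side k L j : ℂ) ν)ᴴ) x x'‖ else 0)
          ≤ B * Real.exp (-(δ * torusSupNorm (Mlev d k N L j)
              (rep (Mlev d k N L j) (B5Blocks16.blockOf (side k L j) (Mlev d k N L j) x) - rep (Mlev d k N L j) y')))) ∧
        (∑ x' : Tor (fine (side k L j) (Mlev d k N L j)),
            (if B5Blocks16.blockOf (side k L j) (Mlev d k N L j) x' = y' then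
              ‖(Gps (side k L j) (Mlev d k N L j) a' * (sdiff (fine (side k L j) (Mlev d k N L j)) (side k L j : ℂ) μ)ᴴ
                  * (sdiff (fine (side k L j) (Mlev d k N L j)) (side k L j : ℂ) ν)ᴴ) x x'‖ else 0)
          ≤ B * (1 + Real.log (side k L j : ℝ)) * Real.exp (-(δ * torusSupNorm (Mlev d k N L j)
              (rep (Mlev d k N L j) (B5Blocks16.blockOf (side k L j) (Mlev d k N L j) x) - rep (Mlev d k N L j) y')))) ∧
        (∑ x' : Tor (fine (side k L j) (Mlev d k N L j)),
            (if B5Blocks16.blockOf (side k L j) (Mlev d k N L j) x' = y' then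
              ‖(sdiff (fine (side k L j) (Mlev d k N L j)) (side k L j : ℂ) ν * Gps (side k L j) (Mlev d k N L j) a') x x'‖ else 0)
          ≤ B * Real.exp (-(δ * torusSupNorm (Mlev d k N L j)
              (rep (Mlev d k N L j) (B5Blocks16.blockOf (side k L j) (Mlev d k N L j) x) - rep (Mlev d k N L j) y')))) ∧
        (∑ x' : Tor (fine (side k L j) (Mlev d k N L j)),
            (if B5Blocks16.blockOf (side k L j) (Mlev d k N L j) x' = y' then
              ‖((sdiff (fine (side k L j) (Mlev d k N L j)) (side k L j : ℂ) μ)ᴴ * sdiff (fine (side k L j) (Mlev d k N L j)) (side k L j : ℂ) ν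
                  * Gps (side k L j) (Mlev d k N L j) a') x x'‖ else 0)
          ≤ B * (1 + Real.log (side k L j : ℝ)) * Real.exp (-(δ * torusSupNorm (Mlev d k N L j)
              (rep (Mlev d k N L j) (B5Blocks16.blockOf (side k L j) (Mlev d k N L j) x) - rep (Mlev d k N L j) y')))) := by
  obtain ⟨B, δ, hB, hδ, h⟩ := scalar_resolventStep d ha' hC hδ₀
  -- one constant for all four letters: the shifted row of (L4) costs `e^{δ(d+1)}`
  refine ⟨B * Real.exp (δ * (d + 1)), δ, by positivity, hδ, fun k N L _ _ j hj hrow μ ν x y' => ?_⟩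
  have hn1 := one_le_side k L j
  have hn : (0 : ℝ) < (side k L j : ℝ) := by exact_mod_cast hn1
  have hside : ((side k L j : ℕ) : ℝ) = (L : ℝ) ^ j := by rw [side, min_eq_left hj, Nat.cast_pow]
  have hlog : 0 ≤ Real.log ((L : ℝ) ^ j) := by rw [← hside]; exact Real.log_nonneg (by exact_mod_cast hn1)
  have hE : 1 ≤ Real.exp (δ * (d + 1)) := Real.one_le_exp (by positivity)
  have hBE : B ≤ B * Real.exp (δ * (d + 1)) := le_mul_of_one_le_right hB.le hE
  -- the row site on the carrier
  obtain ⟨z, rfl⟩ : ∃ z : TPt (d + 1) (N * L ^ k), x = eF d k N L j z := ⟨(eF d k N L j).symm x, by simp⟩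
  have hblk : B5Blocks16.blockOf (side k L j) (Mlev d k N L j) (eF d k N L j z) = cube (d + 1) k N L j z := blockOf_eF d k N L j z
  set T := torusSupNorm (Mlev d k N L j)
    (rep (Mlev d k N L j) (B5Blocks16.blockOf (side k L j) (Mlev d k N L j) (eF d k N L j z)) - rep (Mlev d k N L j) y') with hT
  -- the distance dictionary (pv15's ℓ^∞ torus block distance ≤ NE3's ℓ¹ block distance), at the row `z` and at the shifted row
  have hdist : Real.exp (-(δ * nbd (d + 1) k N L j (cube (d + 1) k N L j z) y')) ≤ Real.exp (-(δ * T)) := by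
    rw [hT, hblk]
    exact Real.exp_le_exp.mpr (neg_le_neg (mul_le_mul_of_nonneg_left (torusSupNorm_rep_sub_rep_le_nbd d k N L j _ _) hδ.le))
  have hdist0 : Real.exp (-(δ * nbd (d + 1) k N L j (cubeI (d + 1) k N L (Fin (d + 1)) j
      ((z, (0 : Fin (d + 1))) : TPt (d + 1) (N * L ^ k) × Fin (d + 1))) y')) ≤ Real.exp (-(δ * T)) := by
    rw [cubeI_apply]; exact hdist
  have hdist1 : Real.exp (-(δ * nbd (d + 1) k N L j (cubeI (d + 1) k N L (Fin (d + 1)) j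
      ((z - Pi.single μ 1, (0 : Fin (d + 1))) : TPt (d + 1) (N * L ^ k) × Fin (d + 1))) y'))
      ≤ Real.exp (δ * (d + 1)) * Real.exp (-(δ * T)) := by
    rw [cubeI_apply]
    exact (exp_nbd_shift_le hδ.le μ z y').trans (mul_le_mul_of_nonneg_left hdist (by positivity))
  obtain ⟨h1, -, h3, h4⟩ := h k N L j hj hrow μ ν (z, 0) y'
  obtain ⟨-, h2, -, -⟩ := h k N L j hj hrow μ ν (z - Pi.single μ 1, 0) y'
  refine ⟨?_, ?_, ?_, ?_⟩
  · -- (L1) `n·Σ_{B(y′)} ‖𝒢′∂_νᴴ‖ ≤ Σ_{Δ_j(y′)} |Gs·colDiff ν| ≤ B·L^j·e^{−δ·nbd}`, and `L^j = n`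
    have hle := block_row_le_cube_row
      (Gps (side k L j) (Mlev d k N L j) a' * (sdiff (fine (side k L j) (Mlev d k N L j)) (side k L j : ℂ) ν)ᴴ)
      ((((side k L j : ℝ) ^ 2) • RI d k N L j
        (reM (Gps (side k L j) (Mlev d k N L j) a') ⊗ₖ (1 : Matrix (Fin (d + 1)) (Fin (d + 1)) ℝ))) * colDiff d k N L ν)
      z (z, 0) (fun x => by rw [abs_Gs_mul_colDiff_eq, if_pos rfl]) y'
    have hfin := (hle.trans h3).trans (mul_le_mul_of_nonneg_left hdist0 (by positivity))
    rw [← hside, mul_comm B, mul_assoc] at hfin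
    exact (le_of_mul_le_mul_left hfin hn).trans (mul_le_mul_of_nonneg_right hBE (by positivity))
  · -- (L3) `Σ_{B(y′)} ‖𝒢′∂_μᴴ∂_νᴴ‖ ≤ Σ_{Δ_j(y′)} |Gs·colDiff μ·colDiff ν| ≤ B·(1 + log L^j)·e^{−δ·nbd}`
    have hle := block_row_le_cube_row
      (Gps (side k L j) (Mlev d k N L j) a' * (sdiff (fine (side k L j) (Mlev d k N L j)) (side k L j : ℂ) μ)ᴴ
        * (sdiff (fine (side k L j) (Mlev d k N L j)) (side k L j : ℂ) ν)ᴴ)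
      ((((side k L j : ℝ) ^ 2) • RI d k N L j
        (reM (Gps (side k L j) (Mlev d k N L j) a') ⊗ₖ (1 : Matrix (Fin (d + 1)) (Fin (d + 1)) ℝ)))
        * colDiff d k N L μ * colDiff d k N L ν)
      z (z, 0) (c := 1) (fun x => by rw [abs_Gs_mul_colDiff_mul_colDiff_eq, if_pos rfl, one_mul]) y'
    rw [one_mul] at hle
    have hfin := (hle.trans h4).trans (mul_le_mul_of_nonneg_left hdist0 (by positivity))
    rw [← hside] at hfin
    exact hfin.trans (mul_le_mul_of_nonneg_right (mul_le_mul_of_nonneg_right hBE (by rw [hside]; positivity)) (by positivity))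
  · -- (L2) `n·Σ_{B(y′)} ‖∂_ν𝒢′‖ ≤ Σ_{Δ_j(y′)} |rowDiff ν Gs| ≤ B·L^j·e^{−δ·nbd}`
    have hle := block_row_le_cube_row
      (sdiff (fine (side k L j) (Mlev d k N L j)) (side k L j : ℂ) ν * Gps (side k L j) (Mlev d k N L j) a')
      (rowDiff d k N L ν (((side k L j : ℝ) ^ 2) • RI d k N L j
        (reM (Gps (side k L j) (Mlev d k N L j) a') ⊗ₖ (1 : Matrix (Fin (d + 1)) (Fin (d + 1)) ℝ))))
      z (z, 0) (fun x => by rw [abs_rowDiff_Gs_eq, if_pos rfl]) y'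
    have hfin := (hle.trans h1).trans (mul_le_mul_of_nonneg_left hdist0 (by positivity))
    rw [← hside, mul_comm B, mul_assoc] at hfin
    exact (le_of_mul_le_mul_left hfin hn).trans (mul_le_mul_of_nonneg_right hBE (by positivity))
  · -- (L4) `Σ_{B(y′)} ‖∂_μᴴ∂_ν𝒢′‖ ≤ Σ_{Δ_j(y′)} |rowDiff μ (rowDiff ν Gs)((z − e_μ, 0), ·)| ≤ B·(1 + log L^j)·e^{−δ·nbd(Δ(z − e_μ), y′)}`
    have hle := block_row_le_cube_row
      ((sdiff (fine (side k L j) (Mlev d k N L j)) (side k L j : ℂ) μ)ᴴ * sdiff (fine (side k L j) (Mlev d k N L j)) (side k L j : ℂ) ν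
        * Gps (side k L j) (Mlev d k N L j) a')
      (rowDiff d k N L μ (rowDiff d k N L ν (((side k L j : ℝ) ^ 2) • RI d k N L j
        (reM (Gps (side k L j) (Mlev d k N L j) a') ⊗ₖ (1 : Matrix (Fin (d + 1)) (Fin (d + 1)) ℝ)))))
      z (z - Pi.single μ 1, 0) (c := 1) (fun x => by rw [abs_rowDiff_rowDiff_Gs_eq, if_pos rfl, one_mul]) y'
    rw [one_mul] at hle
    have hfin := (hle.trans h2).trans (mul_le_mul_of_nonneg_left hdist1 (by positivity))
    rw [← hside] at hfin
    refine hfin.trans (le_of_eq ?_)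
    rw [hside]; ring

end Block

end Summit.QuantumFields.BalabanUV.Beta.GAN24.ScalarFlatResolvent
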